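import Literature.Analysis.Hypoelliptic.FiniteOrder
import Literature.Analysis.Hypoelliptic.Sym
import Mathlib.Analysis.Distribution.SchwartzSpace.Fourier
import HarnessLib

/-!
# The dictionary, I: the complexified localized action and the shadow of `2πi⟪·, w⟫`

Analysis/Hypoelliptic support file serving the discharge of
`Literature.Analysis.Distribution.Hormander1967_thm11` (dictionary between Fourier-side
operators on the Fourier-side function `G_ζ` of a localized distribution `ζ u` and `x`-side
differential operators acting on test functions).

* `uC u ζ h = u(ζ · Re h) + i u(ζ · Im h)` for smooth `h : E → ℂ` (`ℂ`-linear);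
  `fourierFun u ζ T ψ = uC u ζ (conj ∘ 𝓕ψ ∘ T)`.
* `Rep u ζ T H R`: the Fourier-side function `H` REPRESENTS the `x`-side linear operator `R`
  (on smooth complex functions): `pairing H ψ = uC u ζ (R (conj ∘ 𝓕ψ ∘ T))` for all Schwartz `ψ`.
  The Fourier-side function `G_ζ` of `FiniteOrder.lean` represents the identity (`Rep.base`).
* **Shadow of the linear symbol** (`Rep.mulLin`): if `H` represents `R` then `2πi⟪·, w⟫ H`
  represents `R ∘ ∂_v`, `v = T⁻¹ w` (Mathlib: `SchwartzMap.lineDerivOp_fourier_eq`).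

## References

* L. Hörmander, *The Analysis of Linear Partial Differential Operators I*, §7.1 (folklore).
-/

noncomputable section

open MeasureTheory Set Filter Function SchwartzMap TopologicalSpace Distributions TestFunction
open scoped ENNReal NNReal Topology ComplexConjugate InnerProductSpace FourierTransform BigOperators
  ContDiff LineDeriv

namespace Literature.Analysis.Hypoelliptic

variable {E : Type*} [NormedAddCommGroup E] [NormedSpace ℝ E] {Ω : Opens E}

/-! ### The complexified localized action -/

/-- **`uC u ζ h = u(ζ Re h) + i u(ζ Im h)`** for smooth complex `h` (junk `0` otherwise).
[folklore] -/
def uC (u : 𝓓'(Ω, ℝ)) (ζ : 𝓓(Ω, ℝ)) (h : E → ℂ) : ℂ := by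
  classical
  exact if hh : ContDiff ℝ ∞ h then
    (u (mulSmooth ζ (fun x => (h x).re) (Complex.reCLM.contDiff.comp hh)) : ℂ) +
      Complex.I * u (mulSmooth ζ (fun x => (h x).im) (Complex.imCLM.contDiff.comp hh))
  else 0

variable (u : 𝓓'(Ω, ℝ)) (ζ : 𝓓(Ω, ℝ))

/-- Unfolding on smooth functions. [folklore] -/
theorem uC_eq {h : E → ℂ} (hh : ContDiff ℝ ∞ h) :
    uC u ζ h = (u (mulSmooth ζ (fun x => (h x).re) (Complex.reCLM.contDiff.comp hh)) : ℂ) +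
      Complex.I * u (mulSmooth ζ (fun x => (h x).im) (Complex.imCLM.contDiff.comp hh)) := by
  unfold uC
  rw [dif_pos hh]

/-- Additivity. [folklore] -/
theorem uC_add {h g : E → ℂ} (hh : ContDiff ℝ ∞ h) (hg : ContDiff ℝ ∞ g) :
    uC u ζ (fun x => h x + g x) = uC u ζ h + uC u ζ g := by
  rw [uC_eq u ζ (hh.add hg), uC_eq u ζ hh, uC_eq u ζ hg]
  have e1 : mulSmooth ζ (fun x => (h x + g x).re) (Complex.reCLM.contDiff.comp (hh.add hg)) =
      mulSmooth ζ (fun x => (h x).re) (Complex.reCLM.contDiff.comp hh) +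
        mulSmooth ζ (fun x => (g x).re) (Complex.reCLM.contDiff.comp hg) := by
    ext x; simp [mul_add]
  have e2 : mulSmooth ζ (fun x => (h x + g x).im) (Complex.imCLM.contDiff.comp (hh.add hg)) =
      mulSmooth ζ (fun x => (h x).im) (Complex.imCLM.contDiff.comp hh) +
        mulSmooth ζ (fun x => (g x).im) (Complex.imCLM.contDiff.comp hg) := by
    ext x; simp [mul_add]
  rw [e1, e2, map_add, map_add]
  push_cast
  ring

/-- Homogeneity. [folklore] -/
theorem uC_const_mul (c : ℂ) {h : E → ℂ} (hh : ContDiff ℝ ∞ h) :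
    uC u ζ (fun x => c * h x) = c * uC u ζ h := by
  rw [uC_eq u ζ (contDiff_const.mul hh), uC_eq u ζ hh]
  set R := mulSmooth ζ (fun x => (h x).re) (Complex.reCLM.contDiff.comp hh) with hR
  set I := mulSmooth ζ (fun x => (h x).im) (Complex.imCLM.contDiff.comp hh) with hI
  have e1 : mulSmooth ζ (fun x => (c * h x).re) (Complex.reCLM.contDiff.comp (contDiff_const.mul hh)) =
      c.re • R - c.im • I := by
    ext x; simp [hR, hI, Complex.mul_re]; ring
  have e2 : mulSmooth ζ (fun x => (c * h x).im) (Complex.imCLM.contDiff.comp (contDiff_const.mul hh)) =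
      c.re • I + c.im • R := by
    ext x; simp [hR, hI, Complex.mul_im]; ring
  rw [e1, e2, map_sub, map_add, map_smul, map_smul, map_smul, map_smul]
  simp only [smul_eq_mul]
  push_cast
  have hc : c = (c.re : ℂ) + (c.im : ℂ) * Complex.I := (Complex.re_add_im c).symm
  rw [show c * ((u R : ℝ) + Complex.I * (u I : ℝ) : ℂ) =
    ((c.re : ℂ) + (c.im : ℂ) * Complex.I) * ((u R : ℝ) + Complex.I * (u I : ℝ)) by rw [← hc]]
  linear_combination (-(c.im : ℂ) * ((u I : ℝ) : ℂ)) * Complex.I_sq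

/-- Negation. [folklore] -/
theorem uC_neg {h : E → ℂ} (hh : ContDiff ℝ ∞ h) : uC u ζ (fun x => -h x) = -uC u ζ h := by
  have := uC_const_mul u ζ (-1) hh
  simp only [neg_mul, one_mul] at this
  rw [this]

/-- Proof-free congruence. [folklore] -/
theorem uC_congr {h g : E → ℂ} (e : h = g) : uC u ζ h = uC u ζ g := by rw [e]

/-! ### `fourierFun` through `uC` -/

variable {V : Type*} [NormedAddCommGroup V] [InnerProductSpace ℝ V] [FiniteDimensional ℝ V]
  [MeasurableSpace V] [BorelSpace V]

/-- `Φ_ψ = 𝓕ψ ∘ T` is smooth (complex-valued). [folklore] -/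
theorem contDiff_fourier_comp (T : E →L[ℝ] V) (ψ : 𝓢(V, ℂ)) :
    ContDiff ℝ ∞ (fun x : E => 𝓕 ψ (T x)) :=
  ((𝓕 ψ).smooth ⊤).comp T.contDiff

/-- `conj ∘ Φ_ψ` is smooth. [folklore] -/
theorem contDiff_conj_fourier_comp (T : E →L[ℝ] V) (ψ : 𝓢(V, ℂ)) :
    ContDiff ℝ ∞ (fun x : E => conj (𝓕 ψ (T x))) :=
  Complex.conjCLE.contDiff.comp (contDiff_fourier_comp T ψ)

/-- **`fourierFun u ζ T ψ = uC u ζ (conj ∘ 𝓕ψ ∘ T)`.** [folklore] -/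
theorem fourierFun_eq_uC (T : E →L[ℝ] V) (ψ : 𝓢(V, ℂ)) :
    fourierFun u ζ T ψ = uC u ζ (fun x => conj (𝓕 ψ (T x))) := by
  rw [uC_eq u ζ (contDiff_conj_fourier_comp T ψ)]
  unfold fourierFun
  have e1 : mulSmooth ζ (compF T Complex.reCLM ψ) (contDiff_compF T _ ψ) =
      mulSmooth ζ (fun x => (conj (𝓕 ψ (T x))).re)
        (Complex.reCLM.contDiff.comp (contDiff_conj_fourier_comp T ψ) :) := by
    ext x; simp [compF]
  have e2 : mulSmooth ζ (compF T Complex.imCLM ψ) (contDiff_compF T _ ψ) =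
      -mulSmooth ζ (fun x => (conj (𝓕 ψ (T x))).im)
        (Complex.imCLM.contDiff.comp (contDiff_conj_fourier_comp T ψ) :) := by
    ext x; simp [compF]
  rw [e1, e2, map_neg]
  push_cast
  ring

/-! ### Representation of `x`-side operators by Fourier-side functions -/

/-- The directional derivative as an operator on complex functions. [folklore] -/
def derivC (v : E) (h : E → ℂ) : E → ℂ := fun x => fderiv ℝ h x v

/-- `derivC` preserves smoothness. [folklore] -/
theorem contDiff_derivC (v : E) {h : E → ℂ} (hh : ContDiff ℝ ∞ h) : ContDiff ℝ ∞ (derivC v h) := by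
  unfold derivC
  have h1 : ContDiff ℝ ∞ (fderiv ℝ h) := hh.fderiv_right (m := ∞) (mod_cast le_top)
  exact h1.clm_apply contDiff_const

variable {u ζ}

/-- **`H` represents the `x`-side operator `R`**: `pairing H ψ = uC u ζ (R (conj ∘ 𝓕ψ ∘ T))`
for all Schwartz `ψ`, with `R` linear and smoothness-preserving and `H` in some `Ĥ^t`.
[folklore] -/
structure Rep (u : 𝓓'(Ω, ℝ)) (ζ : 𝓓(Ω, ℝ)) (T : E →L[ℝ] V) (H : V → ℂ)
    (R : (E → ℂ) → (E → ℂ)) : Prop where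
  inH : ∃ t, InH t H
  smooth : ∀ h, ContDiff ℝ ∞ h → ContDiff ℝ ∞ (R h)
  add : ∀ (h g : E → ℂ), ContDiff ℝ ∞ h → ContDiff ℝ ∞ g →
    R (fun x => h x + g x) = fun x => R h x + R g x
  hom : ∀ (c : ℂ) (h : E → ℂ), ContDiff ℝ ∞ h → R (fun x => c * h x) = fun x => c * R h x
  eq : ∀ ψ : 𝓢(V, ℂ), pairing H ψ = uC u ζ (R (fun x => conj (𝓕 ψ (T x))))

/-- `R (-h) = -R h` for a represented operator. [folklore] -/
theorem Rep.map_neg {T : E →L[ℝ] V} {H : V → ℂ} {R : (E → ℂ) → (E → ℂ)} (hR : Rep u ζ T H R)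
    {h : E → ℂ} (hh : ContDiff ℝ ∞ h) : R (fun x => -h x) = fun x => -R h x := by
  have := hR.hom (-1) h hh
  simp only [neg_mul, one_mul] at this
  exact this

/-- **The base case**: the Fourier-side function `G_ζ` of `FiniteOrder.lean` represents the
identity. [folklore] -/
theorem Rep.base (u : 𝓓'(Ω, ℝ)) (ζ : 𝓓(Ω, ℝ)) (T : E →L[ℝ] V) :
    ∃ G : V → ℂ, Rep u ζ T G id := by
  obtain ⟨M, G, hG, hGp⟩ := exists_fourierSide u ζ T
  refine ⟨G, ⟨⟨-M, hG⟩, fun h hh => hh, fun h g _ _ => rfl, fun c h _ => rfl, fun ψ => ?_⟩⟩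
  rw [hGp, fourierFun_eq_uC]; rfl

/-! ### The shadow of the linear symbol -/

omit [MeasurableSpace V] [BorelSpace V] [FiniteDimensional ℝ V] in
/-- `linMul w` has temperate growth. [folklore] -/
theorem hasTemperateGrowth_linMul (w : V) : (linMul w).HasTemperateGrowth := by
  have h : (fun ξ : V => (2 * Real.pi * Complex.I) * ((⟪ξ, w⟫_ℝ : ℝ) : ℂ)) =
      linMul w := by ext ξ; rw [linMul_apply]
  rw [← h]
  have h1 : (fun ξ : V => ((⟪ξ, w⟫_ℝ : ℝ) : ℂ)).HasTemperateGrowth :=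
    (Complex.ofRealCLM.hasTemperateGrowth).comp ((innerSL ℝ).flip w).hasTemperateGrowth
  exact (Function.HasTemperateGrowth.const _).mul h1

/-- Multiplication by `2πi⟪·, w⟫` on the Schwartz space. [folklore] -/
def linSchwartz (w : V) : 𝓢(V, ℂ) →L[ℂ] 𝓢(V, ℂ) := SchwartzMap.smulLeftCLM ℂ (linMul w)

omit [MeasurableSpace V] [BorelSpace V] [FiniteDimensional ℝ V] in
/-- Pointwise formula. [folklore] -/
@[simp] theorem linSchwartz_apply (w : V) (ψ : 𝓢(V, ℂ)) (ξ : V) :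
    linSchwartz w ψ ξ = linMul w ξ * ψ ξ := by
  unfold linSchwartz
  rw [SchwartzMap.smulLeftCLM_apply_apply (hasTemperateGrowth_linMul w)]
  rfl

/-- **`𝓕 (2πi⟪·,w⟫ ψ) = -∂_w 𝓕ψ`** pointwise. [folklore] -/
theorem fourier_linSchwartz_apply (w : V) (ψ : 𝓢(V, ℂ)) (y : V) :
    𝓕 (linSchwartz w ψ) y = -(fderiv ℝ (𝓕 (ψ : V → ℂ)) y w) := by
  have h := SchwartzMap.lineDerivOp_fourier_eq ψ w
  -- `∂_w (𝓕ψ) = 𝓕 (-(2πi) • (inner · w) ψ)` and `-(2πi) • (inner · w) ψ = -linSchwartz w ψ`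
  have hin : (fun ξ : V => ⟪ξ, w⟫_ℝ).HasTemperateGrowth := ((innerSL ℝ).flip w).hasTemperateGrowth
  have e : (-(2 * Real.pi * Complex.I) • SchwartzMap.smulLeftCLM ℂ (fun ξ : V => ⟪ξ, w⟫_ℝ) ψ : 𝓢(V, ℂ)) =
      -linSchwartz w ψ := by
    ext ξ
    simp only [smul_apply, neg_apply, linSchwartz_apply, linMul_apply,
      SchwartzMap.smulLeftCLM_apply_apply hin, smul_eq_mul, Complex.real_smul]
    ring
  rw [e, show 𝓕 (-(linSchwartz w ψ)) = -𝓕 (linSchwartz w ψ) from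
    (SchwartzMap.fourierTransformCLM ℂ).map_neg _] at h
  have hy := congrArg (fun f : 𝓢(V, ℂ) => f y) h
  simp only [neg_apply] at hy
  rw [SchwartzMap.lineDerivOp_apply] at hy
  rw [DifferentiableAt.lineDeriv_eq_fderiv (SchwartzMap.differentiableAt _)] at hy
  rw [← SchwartzMap.fourier_coe]
  linear_combination hy

/-- **Shadow of the linear symbol**: if `H` represents `R` then `2πi⟪·, w⟫ H` represents
`R ∘ ∂_{T⁻¹ w}`. [folklore] -/
theorem Rep.mulLin {T : E ≃L[ℝ] V} {H : V → ℂ} {R : (E → ℂ) → (E → ℂ)}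
    (hR : Rep u ζ (T : E →L[ℝ] V) H R) (w : V) :
    Rep u ζ (T : E →L[ℝ] V) (fun ξ => linMul w ξ * H ξ) (fun h => R (derivC (T.symm w) h)) := by
  obtain ⟨t, ht⟩ := hR.inH
  refine ⟨⟨t - 1, (mulBound_linMul w).inH_mul ht⟩, fun h hh => hR.smooth _ (contDiff_derivC _ hh),
    fun h g hh hg => ?_, fun c h hh => ?_, fun ψ => ?_⟩
  · have e : derivC (T.symm w) (fun x => h x + g x) = fun x => derivC (T.symm w) h x + derivC (T.symm w) g x := by
      ext x
      unfold derivC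
      have hd : DifferentiableAt ℝ h x := (hh.differentiable (by simp)).differentiableAt
      have gd : DifferentiableAt ℝ g x := (hg.differentiable (by simp)).differentiableAt
      rw [fderiv_fun_add hd gd]
      simp
    rw [e, hR.add _ _ (contDiff_derivC _ hh) (contDiff_derivC _ hg)]
  · have e : derivC (T.symm w) (fun x => c * h x) = fun x => c * derivC (T.symm w) h x := by
      ext x
      unfold derivC
      have hd : DifferentiableAt ℝ h x := (hh.differentiable (by simp)).differentiableAt
      rw [fderiv_const_mul hd]
      simp
    rw [e, hR.hom c _ (contDiff_derivC _ hh)]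
  · -- `pairing (lin · H) ψ = pairing H (conj(lin) ψ) = -pairing H (lin ψ)`
    rw [pairing_mul_left]
    have e1 : (fun ξ => conj (linMul w ξ) * ψ ξ) = fun ξ => -((linSchwartz w ψ : 𝓢(V, ℂ)) ξ) := by
      ext ξ; rw [Sym.conj_linMul, linSchwartz_apply]; ring
    rw [e1, pairing_neg_right, hR.eq (linSchwartz w ψ)]
    -- the derivative of `𝓕ψ` at `T x` in direction `w`
    set D : E → ℂ := fun x => conj (fderiv ℝ (𝓕 (ψ : V → ℂ)) (T x) w) with hD
    have hFd : ContDiff ℝ ∞ (𝓕 (ψ : V → ℂ)) := by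
      have := (𝓕 ψ).smooth ⊤; rwa [SchwartzMap.fourier_coe] at this
    have hDs : ContDiff ℝ ∞ D := by
      have h1 : ContDiff ℝ ∞ (fderiv ℝ (𝓕 (ψ : V → ℂ))) := hFd.fderiv_right (m := ∞) (mod_cast le_top)
      exact Complex.conjCLE.contDiff.comp ((h1.comp (T : E →L[ℝ] V).contDiff).clm_apply contDiff_const)
    have e2 : (fun x => conj (𝓕 (linSchwartz w ψ) ((T : E →L[ℝ] V) x))) = fun x => -D x := by
      ext x
      simp only [hD, ContinuousLinearEquiv.coe_coe]
      rw [fourier_linSchwartz_apply]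
      exact _root_.map_neg (starRingEnd ℂ) _
    have e3 : derivC (T.symm w) (fun x => conj (𝓕 ψ ((T : E →L[ℝ] V) x))) = D := by
      ext x
      simp only [hD, derivC, ContinuousLinearEquiv.coe_coe]
      have h1 : HasFDerivAt (fun x : E => 𝓕 (ψ : V → ℂ) (T x))
          ((fderiv ℝ (𝓕 (ψ : V → ℂ)) (T x)).comp (T : E →L[ℝ] V)) x :=
        ((hFd.differentiable (by simp)).differentiableAt.hasFDerivAt).comp x
          (T : E →L[ℝ] V).hasFDerivAt
      have h2 : HasFDerivAt (fun x : E => conj (𝓕 (ψ : V → ℂ) (T x)))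
          ((Complex.conjCLE : ℂ →L[ℝ] ℂ).comp ((fderiv ℝ (𝓕 (ψ : V → ℂ)) (T x)).comp (T : E →L[ℝ] V))) x :=
        (Complex.conjCLE : ℂ →L[ℝ] ℂ).hasFDerivAt.comp x h1
      rw [← SchwartzMap.fourier_coe] at h2 ⊢
      rw [h2.fderiv]
      simp
    rw [e2, hR.map_neg hDs, uC_neg u ζ (hR.smooth _ hDs), e3, neg_neg]

end Literature.Analysis.Hypoelliptic
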